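import Mathlib.LinearAlgebra.Eigenspace.Basic
import Literature.RepresentationTheory.FiniteGroups.AldousLambdaOne
import Literature.NumberTheory.DiophantineGeometry.KroneckerOneRow
import HarnessLib

/-!
# The Aldous order on the irreducible representations of `𝔖ₙ`; `Δ_A` in an arbitrary representation

Topic `Literature/RepresentationTheory/FiniteGroups`; companion of `AldousLambdaOne.lean` (Aldous'
`λ₁(A; μ) = aldousLambdaOneFin n A μ`, the bottom of the interchange Laplacian
`L_A = ∑_{x<y} a_{xy} (1 − (x y))` on the `μ`-isotypic component of `ℂ[𝔖ₙ]`), supplying the three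
follow-ups listed there and requested with the notion (definition item `defn-AldousLambdaOne`, route
`HubbardSuperconductivity/HyperoctahedralMott`): the **Aldous order**, the **Caputo–Liggett–Richthammer
theorem** as a named fact, and the **complete-graph formula** (Diaconis–Shahshahani) as a named fact;
together with the source's `Δ_A` as an element of the group algebra and its image `ρ(Δ_A)` in an
ARBITRARY representation `ρ` (Alon–Kozma define `λ₁(A; ρ)` for every representation, eq. (1)).

Alon–Kozma, *Ordering the representations of `S_n` using the interchange process*, §1:

> "Let `A = {a_{i,j}}_{1 ≤ i < j ≤ n}` with all `a_{i,j}` non-negative. Examine […]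
> `Δ_A = ∑_{i<j} a_{i,j} (id − (ij))` […]. Let `ρ` be any representation of `S_n`. Then
> (1) `ρ(Δ_A) = ∑_{i<j} a_{i,j} (ρ(id) − ρ((ij)))` […]. We shall denote the eigenvalues of `ρ(Δ_A)` by
> `λ₁(A;ρ) ≤ ⋯ ≤ λ_{dim ρ}(A;ρ)`. […]
> **Theorem (Caputo, Liggett & Richthammer).** For any `A` and any irreducible `ρ` different from the
> trivial representation `[n]`, `λ₁(A;[n−1,1]) ≤ λ₁(A;ρ)`. […]
> Define the **Aldous order** on irreducible representations by
> `ρ ⪯ σ ⟺ ∀ A λ₁(A;ρ) ≥ λ₁(A;σ)`, where again by `∀ A` we mean for all `n × n` matrices with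
> non-negative coefficients. It is rather unfortunate that the *largest* representation in the `≺`
> order has the *smallest* `λ₁`, but we wish to make `≺` consistent with the domination order."

## Contents

* `interchangeElement A : ℂ[𝔖_V]` — `Δ_A` for a weight `A : V → V → ℝ` on a finite linearly ordered
  vertex type (entries `A x y`, `x < y`; complex coefficients, to act in complex representations);
* `interchangeLaplacianRep A ρ = ρ(Δ_A)` for any complex representation `ρ` of `Equiv.Perm V`
  (Mathlib `Representation.asAlgebraHom`); `interchangeLaplacianRep_eq_sum` (eq. (1)),
  `interchangeLaplacianRep_eq_half_sum` (symmetric weights: `½ ∑_x ∑_y a_{xy}(1 − ρ((x y)))`, the form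
  used by the route's Fock-space Laplacian), `interchangeLaplacianRep_eq_zero_of_forall_swap`, and the
  bridge `interchangeLaplacianRep_permLeftRegular : ρ(Δ_A) = interchangeLaplacian n A` for
  `ρ = permLeftRegular n` of `AldousLambdaOne.lean`;
* `lambdaOneRep A ρ = λ₁(A; ρ)` for an arbitrary representation: the infimum of the real eigenvalues
  of `ρ(Δ_A)` (`lambdaOneRep_eq_zero_of_eq_zero`, `lambdaOneRep_eq_of_eq_smul_one`);
* `AldousLE ρ σ` — the Aldous order `ρ ⪯ σ` on `Nat.Partition n` (`AldousLE.refl/trans`, and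
  `aldousLE_indiscrete : σ ⪯ [n]`, Alon–Kozma Cor. 2, PROVED from `aldousLambdaOneFin_indiscrete/nonneg`);
* `contentSum μ = ∑_{(i,j) ∈ μ} (j − i)` (`contentSum_indiscrete : contentSum [n] = n(n−1)/2`);
* named facts `CaputoLiggettRichthammer_lambdaOne` (with the PROVED corollary
  `CaputoLiggettRichthammer_lambdaOne.aldousLE : [n−1,1] ⪰ μ`) and
  `DiaconisShahshahani_lambdaOne_complete` (`λ₁(K_n; μ) = n(n−1)/2 − contentSum μ`).

## References

* G. Alon, G. Kozma, *Ordering the representations of `S_n` using the interchange process*,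
  Canad. Math. Bull. 56 (2013) 13–30, arXiv:1003.1710: §1 (eq. (1), CLR theorem, Aldous order), §3
  (proof of Lemma 3 (2): the scalar of `Δ_{K_n}` on `[α]`), §4 Cor. 2 (`[n] ⪰ σ ⪰ [1ⁿ]`).
  [AlonKozma2013]
* P. Caputo, T. M. Liggett, T. Richthammer, *Proof of Aldous' spectral gap conjecture*, J. Amer.
  Math. Soc. 23 (2010) 831–851, Theorem 1.1. [CaputoLiggettRichthammer2010]
* P. Diaconis, M. Shahshahani, *Generating a random permutation with random transpositions*,
  Z. Wahrsch. Verw. Gebiete 57 (1981) 159–179, Lemma 7 and Cor. 1. [DiaconisShahshahani1981]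

## Mathlib and tree

Mathlib: `MonoidAlgebra.of`, `Representation.asAlgebraHom` (`asAlgebraHom_of`),
`Module.End.HasEigenvalue` (`hasEigenvalue_iff`, `mem_eigenspace_iff`), `Equiv.swap`,
`Finset.sum_filter`, `Nat.Partition.indiscrete`, `YoungDiagram`, `Finset.sum_range_id_mul_two`,
`Nat.choose_two_right`. Tree: `permLeftRegular`, `interchangeLaplacian`, `aldousLambdaOneFin`,
`aldousLambdaOneFin_nonneg`, `aldousLambdaOneFin_indiscrete` (`AldousLambdaOne.lean`);
`Nat.Partition.youngDiagram`, `mem_youngDiagram_iff`, `sortedParts_indiscrete`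
(`Literature/NumberTheory/DiophantineGeometry/{PartitionTableaux,KroneckerOneRow}`).

## Design

* `V : Type*` with `[Fintype V] [LinearOrder V] [DecidableEq V]`: the transpositions `Equiv.swap x y`
  are written with the ambient `DecidableEq` instance (for `Lex`-types such as the route's
  `FermionTorus 2 L = Lex (Fin 2 → Fin L)` it differs syntactically from `LinearOrder.toDecidableEq`),
  the order only decides `x < y`.
* The order and the two facts are phrased with `aldousLambdaOneFin n` on the vertex set `Fin n`, the
  source's `{1, …, n}` ("all `n × n` matrices with non-negative coefficients"); `aldousLambdaOneFin`
  reads only the entries `A x y`, `x < y`.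
* `lambdaOneRep` is an `sInf` over real eigenvalues with junk value `sInf ∅ = 0` (the zero space only:
  on a nonzero finite-dimensional representation `ρ(Δ_A)` is self-adjoint for an invariant inner
  product). Its agreement with `aldousLambdaOneFin n A μ` on an irreducible `ρ ≅ [μ]` (Alon–Kozma §1)
  is not proved here.
-/

noncomputable section

open scoped BigOperators
open Module Module.End
open Literature.NumberTheory.DiophantineGeometry (sortedParts_indiscrete)

namespace Literature.RepresentationTheory.FiniteGroups

/-! ### `Δ_A ∈ ℂ[𝔖_V]` and `ρ(Δ_A)` for an arbitrary representation -/

section Laplacian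

variable {V : Type*} [Fintype V] [LinearOrder V] [DecidableEq V]

/-- **The interchange element** `Δ_A = ∑_{x<y} a_{xy} (id − (x y))` of the group algebra of
`𝔖_V = Equiv.Perm V`, for a weight `A` on the finite linearly ordered vertex set `V` (only the
entries `A x y` with `x < y` enter). The source takes real coefficients ("element of the group ring
`ℝ[S_n]`"); we take them in `ℂ[𝔖_V]` so that `Δ_A` can be evaluated in complex representations.
[cite: AlonKozma2013, §1 (definition of Δ_A)] -/
def interchangeElement (A : V → V → ℝ) : MonoidAlgebra ℂ (Equiv.Perm V) :=
  ∑ x : V, ∑ y : V,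
    if x < y then (A x y : ℂ) • (1 - MonoidAlgebra.of ℂ (Equiv.Perm V) (Equiv.swap x y)) else 0

variable {W : Type*} [AddCommGroup W] [Module ℂ W]

/-- **The interchange Laplacian in a representation** `ρ` of `𝔖_V`:
`ρ(Δ_A) = ∑_{x<y} a_{xy} (ρ(id) − ρ((x y)))` (Alon–Kozma eq. (1), "`ρ` any representation of `S_n`"),
the image of `Δ_A` under the algebra map `ℂ[𝔖_V] → End(W)` of `ρ` (Mathlib
`Representation.asAlgebraHom`). For `ρ` the left regular representation this is
`interchangeLaplacian` of `AldousLambdaOne.lean` (`interchangeLaplacianRep_permLeftRegular`).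
[cite: AlonKozma2013, §1 eq. (1)] -/
def interchangeLaplacianRep (A : V → V → ℝ) (ρ : Representation ℂ (Equiv.Perm V) W) :
    Module.End ℂ W :=
  ρ.asAlgebraHom (interchangeElement A)

/-- Unfolding, eq. (1) of the source: `ρ(Δ_A) = ∑_{x<y} a_{xy} (1 − ρ((x y)))`.
[cite: AlonKozma2013, §1 eq. (1)] -/
theorem interchangeLaplacianRep_eq_sum (A : V → V → ℝ) (ρ : Representation ℂ (Equiv.Perm V) W) :
    interchangeLaplacianRep A ρ =
      ∑ x : V, ∑ y : V, if x < y then (A x y : ℂ) • (1 - ρ (Equiv.swap x y)) else 0 := by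
  simp only [interchangeLaplacianRep, interchangeElement, map_sum]
  refine Finset.sum_congr rfl fun x _ => Finset.sum_congr rfl fun y _ => ?_
  split_ifs
  · rw [map_smul, map_sub, map_one, Representation.asAlgebraHom_of]
  · exact map_zero _

/-- Pointwise form of eq. (1): `ρ(Δ_A) w = ∑_{x<y} a_{xy} (w − ρ((x y)) w)`.
[cite: AlonKozma2013, §1 eq. (1)] -/
theorem interchangeLaplacianRep_apply (A : V → V → ℝ) (ρ : Representation ℂ (Equiv.Perm V) W)
    (w : W) :
    interchangeLaplacianRep A ρ w =
      ∑ x : V, ∑ y : V, if x < y then (A x y : ℂ) • (w - ρ (Equiv.swap x y) w) else 0 := by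
  rw [interchangeLaplacianRep_eq_sum, LinearMap.sum_apply]
  refine Finset.sum_congr rfl fun x _ => ?_
  rw [LinearMap.sum_apply]
  refine Finset.sum_congr rfl fun y _ => ?_
  split_ifs
  · rfl
  · rfl

/-- If every transposition `(x y)`, `x < y`, acts as the identity, then `ρ(Δ_A) = 0` (each term
`ρ(id) − ρ((x y))` vanishes; e.g. on the trivial representation `[n]`, Alon–Kozma Cor. 2: "`[n]` is
the trivial representation, so `λ₁(A;[n]) = 0`"). [cite: AlonKozma2013, §4 Cor. 2 (proof)] -/
theorem interchangeLaplacianRep_eq_zero_of_forall_swap (A : V → V → ℝ)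
    (ρ : Representation ℂ (Equiv.Perm V) W) (h : ∀ x y : V, x < y → ρ (Equiv.swap x y) = 1) :
    interchangeLaplacianRep A ρ = 0 := by
  rw [interchangeLaplacianRep_eq_sum]
  refine Finset.sum_eq_zero fun x _ => Finset.sum_eq_zero fun y _ => ?_
  split_ifs with hxy
  · rw [h x y hxy, sub_self, smul_zero]
  · rfl

/-- **Symmetric weights**: for `a_{xy} = a_{yx}` the interchange Laplacian is half the sum over
ORDERED pairs, `ρ(Δ_A) = ½ ∑_x ∑_y a_{xy} (1 − ρ((x y)))` (the diagonal terms vanish as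
`(x x) = id`). This is the form in which the route `HubbardSuperconductivity/HyperoctahedralMott`
writes its interchange Laplacian `ℒ = ½ ∑_x ∑_y [x ∼ y] (1 − π(xy))`. [folklore] -/
theorem interchangeLaplacianRep_eq_half_sum (A : V → V → ℝ) (ρ : Representation ℂ (Equiv.Perm V) W)
    (hA : ∀ x y, A x y = A y x) :
    interchangeLaplacianRep A ρ =
      (1 / 2 : ℂ) • ∑ x : V, ∑ y : V, (A x y : ℂ) • (1 - ρ (Equiv.swap x y)) := by
  set f : V → V → Module.End ℂ W := fun x y => (A x y : ℂ) • (1 - ρ (Equiv.swap x y)) with hf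
  have hdiag : ∀ x, f x x = 0 := fun x => by
    simp only [hf, Equiv.swap_self, Equiv.Perm.one_def.symm, map_one, sub_self, smul_zero]
  have hsymm : ∀ x y, f x y = f y x := fun x y => by
    simp only [hf, hA x y, Equiv.swap_comm]
  have hsplit : ∀ x y, f x y = (if x < y then f x y else 0) + (if y < x then f x y else 0) := by
    intro x y
    rcases lt_trichotomy x y with hlt | rfl | hgt
    · rw [if_pos hlt, if_neg (not_lt.mpr hlt.le), add_zero]
    · rw [if_neg (lt_irrefl _), hdiag, add_zero]
    · rw [if_neg (not_lt.mpr hgt.le), if_pos hgt, zero_add]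
  have hL : interchangeLaplacianRep A ρ = ∑ x : V, ∑ y : V, if x < y then f x y else 0 :=
    interchangeLaplacianRep_eq_sum A ρ
  have hsum : ∑ x : V, ∑ y : V, f x y = (2 : ℂ) • interchangeLaplacianRep A ρ := by
    rw [hL, two_smul]
    calc ∑ x : V, ∑ y : V, f x y
        = ∑ x : V, ∑ y : V, ((if x < y then f x y else 0) + (if y < x then f x y else 0)) :=
          Finset.sum_congr rfl fun x _ => Finset.sum_congr rfl fun y _ => hsplit x y
      _ = (∑ x : V, ∑ y : V, if x < y then f x y else 0) +
            ∑ x : V, ∑ y : V, if y < x then f x y else 0 := by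
          simp only [Finset.sum_add_distrib]
      _ = (∑ x : V, ∑ y : V, if x < y then f x y else 0) +
            ∑ x : V, ∑ y : V, if x < y then f x y else 0 := by
          congr 1
          rw [Finset.sum_comm]
          exact Finset.sum_congr rfl fun x _ => Finset.sum_congr rfl fun y _ => by
            split_ifs <;> simp [hsymm x y]
  change interchangeLaplacianRep A ρ = (1 / 2 : ℂ) • ∑ x : V, ∑ y : V, f x y
  rw [hsum, smul_smul]
  norm_num

/-- **Bridge to `AldousLambdaOne.lean`**: in the left regular representation `λ` of `𝔖ₙ` on
`𝔖ₙ → ℂ` (`permLeftRegular n`), `λ(Δ_A)` is the interchange Laplacian `L_A = interchangeLaplacian n A`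
whose Rayleigh quotients define `aldousLambdaOneFin`. [cite: AlonKozma2013, §1 eq. (1)] -/
theorem interchangeLaplacianRep_permLeftRegular (n : ℕ) (A : Fin n → Fin n → ℝ) :
    interchangeLaplacianRep A (permLeftRegular n) = interchangeLaplacian n A := by
  rw [interchangeLaplacianRep_eq_sum, interchangeLaplacian]
  exact Finset.sum_congr rfl fun x _ => (Finset.sum_filter _ _).symm

/-! ### `λ₁(A; ρ)` for an arbitrary representation -/

/-- **Aldous' `λ₁(A; ρ)` for a representation `ρ` of `𝔖_V`**: the least eigenvalue of `ρ(Δ_A)`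
("Let `ρ` be any representation of `S_n` […] We shall denote the eigenvalues of `ρ(Δ_A)` by
`λ₁(A;ρ) ≤ ⋯ ≤ λ_{dim ρ}(A;ρ)`"), formalised as the infimum of the real numbers `t` that are
eigenvalues of `ρ(Δ_A)` (Mathlib `Module.End.HasEigenvalue`). On a nonzero finite-dimensional
representation all eigenvalues of `ρ(Δ_A)` are real (it is self-adjoint for an invariant inner
product, indeed positive semi-definite for `A ≥ 0`), so this is the least eigenvalue; **junk value**
`sInf ∅ = 0` on the zero space. For `ρ` irreducible of type `μ ⊢ n` this is the number
`aldousLambdaOneFin n A μ` of `AldousLambdaOne.lean` (not proved here).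
[cite: AlonKozma2013, §1 (after eq. (1))] -/
def lambdaOneRep (A : V → V → ℝ) (ρ : Representation ℂ (Equiv.Perm V) W) : ℝ :=
  sInf {t : ℝ | (interchangeLaplacianRep A ρ).HasEigenvalue (t : ℂ)}

/-- Unfolding lemma for `lambdaOneRep`. [cite: AlonKozma2013, §1 (after eq. (1))] -/
theorem lambdaOneRep_def (A : V → V → ℝ) (ρ : Representation ℂ (Equiv.Perm V) W) :
    lambdaOneRep A ρ = sInf {t : ℝ | (interchangeLaplacianRep A ρ).HasEigenvalue (t : ℂ)} :=
  rfl

/-- On a nonzero space the scalar endomorphism `c • 1` has exactly one eigenvalue, `c`. [folklore] -/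
theorem hasEigenvalue_smul_one_iff [Nontrivial W] (c t : ℂ) :
    (c • (1 : Module.End ℂ W)).HasEigenvalue t ↔ t = c := by
  rw [Module.End.hasEigenvalue_iff, ne_eq, Submodule.eq_bot_iff, not_forall]
  constructor
  · rintro ⟨w, hw⟩
    rw [Classical.not_imp] at hw
    obtain ⟨hw, hw0⟩ := hw
    rw [Module.End.mem_eigenspace_iff, LinearMap.smul_apply, Module.End.one_apply] at hw
    have : (c - t) • w = 0 := by rw [sub_smul, hw, sub_self]
    rw [smul_eq_zero, sub_eq_zero] at this
    exact (this.resolve_right hw0).symm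
  · rintro rfl
    obtain ⟨w, hw⟩ := exists_ne (0 : W)
    refine ⟨w, ?_⟩
    rw [Classical.not_imp, Module.End.mem_eigenspace_iff, LinearMap.smul_apply,
      Module.End.one_apply]
    exact ⟨rfl, hw⟩

/-- If `ρ(Δ_A)` is the real scalar `c` on a nonzero representation then `λ₁(A; ρ) = c`.
[folklore] -/
theorem lambdaOneRep_eq_of_eq_smul_one [Nontrivial W] {A : V → V → ℝ}
    {ρ : Representation ℂ (Equiv.Perm V) W} {c : ℝ}
    (h : interchangeLaplacianRep A ρ = (c : ℂ) • (1 : Module.End ℂ W)) :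
    lambdaOneRep A ρ = c := by
  have hset : {t : ℝ | (interchangeLaplacianRep A ρ).HasEigenvalue (t : ℂ)} = {c} := by
    ext t
    rw [Set.mem_setOf_eq, Set.mem_singleton_iff, h, hasEigenvalue_smul_one_iff,
      Complex.ofReal_inj]
  rw [lambdaOneRep, hset, csInf_singleton]

/-- If `ρ(Δ_A) = 0` on a nonzero representation then `λ₁(A; ρ) = 0` (the spectrum is `{0}`), e.g.
for the trivial representation. [cite: AlonKozma2013, §4 Cor. 2 (proof: "λ₁(A;[n]) = 0")] -/
theorem lambdaOneRep_eq_zero_of_eq_zero [Nontrivial W] {A : V → V → ℝ}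
    {ρ : Representation ℂ (Equiv.Perm V) W} (h : interchangeLaplacianRep A ρ = 0) :
    lambdaOneRep A ρ = 0 :=
  lambdaOneRep_eq_of_eq_smul_one (c := 0) (by rw [h, Complex.ofReal_zero, zero_smul])

end Laplacian

/-! ### The Aldous order -/

section Order

variable {n : ℕ}

/-- **The Aldous order** on the irreducible representations of `𝔖ₙ`, indexed by the partitions of
`n`: `ρ ⪯ σ :⟺ ∀ A, λ₁(A; ρ) ≥ λ₁(A; σ)`, "where again by `∀ A` we mean for all `n × n` matrices with
non-negative coefficients" (`λ₁ = aldousLambdaOneFin n`, which reads the entries above the diagonal).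
Direction as in the source: "the *largest* representation in the `≺` order has the *smallest* `λ₁`
[…] consistent with the domination order"; thus `[n] ⪰ σ ⪰ [1ⁿ]` for every `σ` (Cor. 2,
`aldousLE_indiscrete`) and the CLR theorem reads `[n−1,1] ⪰ ρ` for `ρ ≠ [n]`. `AldousLE ρ σ` is
`ρ ⪯ σ`. [cite: AlonKozma2013, §1 (definition of the Aldous order)] -/
def AldousLE (ρ σ : Nat.Partition n) : Prop :=
  ∀ A : Fin n → Fin n → ℝ, (∀ i j, 0 ≤ A i j) → aldousLambdaOneFin n A σ ≤ aldousLambdaOneFin n A ρ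

/-- Unfolding lemma for `AldousLE`. [cite: AlonKozma2013, §1] -/
theorem aldousLE_iff (ρ σ : Nat.Partition n) :
    AldousLE ρ σ ↔
      ∀ A : Fin n → Fin n → ℝ, (∀ i j, 0 ≤ A i j) →
        aldousLambdaOneFin n A σ ≤ aldousLambdaOneFin n A ρ :=
  Iff.rfl

/-- The Aldous order is reflexive. [folklore] -/
theorem AldousLE.refl (ρ : Nat.Partition n) : AldousLE ρ ρ := fun _ _ => le_rfl

/-- The Aldous order is transitive. (Antisymmetry — `ρ ⪯ σ ⪯ ρ ⟹ ρ = σ` — is Alon–Kozma's Remark 1,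
§3.1, via quasi-complete graphs; not proved here.) [folklore] -/
theorem AldousLE.trans {ρ σ τ : Nat.Partition n} (h₁ : AldousLE ρ σ) (h₂ : AldousLE σ τ) :
    AldousLE ρ τ := fun A hA => (h₂ A hA).trans (h₁ A hA)

/-- **`[n]` is the top of the Aldous order**: `σ ⪯ [n]` for every `σ`, since `λ₁(A;[n]) = 0 ≤ λ₁(A;σ)`
(Alon–Kozma Cor. 2, first half; `aldousLambdaOneFin_indiscrete`, `aldousLambdaOneFin_nonneg`).
[cite: AlonKozma2013, §4 Cor. 2] -/
theorem aldousLE_indiscrete (σ : Nat.Partition n) : AldousLE σ (Nat.Partition.indiscrete n) :=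
  fun A hA => by
    rw [aldousLambdaOneFin_indiscrete n hA]
    exact aldousLambdaOneFin_nonneg n hA σ

end Order

/-! ### The content of a partition -/

section Content

variable {n : ℕ}

/-- **The content of a partition**: `contentSum μ = ∑_{(i,j) ∈ μ} (j − i)`, summed over the boxes of
the Young diagram of `μ` (row `i`, column `j`, both counted from `0`); equivalently
`∑_j (binom(l_j − j + 1, 2) − binom(j, 2))` over the rows `l_1 ≥ ⋯ ≥ l_m` as in Alon–Kozma §3 (this is
the eigenvalue of the class sum of transpositions on `[μ]`, Jucys–Murphy).
[cite: AlonKozma2013, §3 (proof of Lemma 3 (2))] -/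
def contentSum (μ : Nat.Partition n) : ℤ :=
  ∑ c ∈ μ.youngDiagram.cells, ((c.2 : ℤ) - (c.1 : ℤ))

/-- Unfolding lemma for `contentSum`. [cite: AlonKozma2013, §3] -/
theorem contentSum_def (μ : Nat.Partition n) :
    contentSum μ = ∑ c ∈ μ.youngDiagram.cells, ((c.2 : ℤ) - (c.1 : ℤ)) :=
  rfl

/-- The boxes of the one-row shape `[n]` are `(0, 0), …, (0, n−1)`. [folklore] -/
theorem cells_youngDiagram_indiscrete (hn : n ≠ 0) :
    (Nat.Partition.indiscrete n).youngDiagram.cells =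
      (Finset.range n).map ⟨fun j => ((0 : ℕ), j), fun _ _ h => (Prod.ext_iff.mp h).2⟩ := by
  ext ⟨i, j⟩
  simp only [YoungDiagram.mem_cells, Nat.Partition.mem_youngDiagram_iff, sortedParts_indiscrete hn,
    List.length_singleton, Nat.lt_one_iff, Finset.mem_map, Finset.mem_range,
    Function.Embedding.coeFn_mk, Prod.mk.injEq]
  constructor
  · rintro ⟨rfl, hj⟩
    exact ⟨j, by simpa using hj, rfl, rfl⟩
  · rintro ⟨j', hj', hi, rfl⟩
    subst hi
    exact ⟨rfl, by simpa using hj'⟩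

/-- `contentSum [n] = 0 + 1 + ⋯ + (n−1) = n(n−1)/2`; with the complete-graph formula this recovers
`λ₁(K_n; [n]) = 0`. [folklore] -/
theorem contentSum_indiscrete (n : ℕ) :
    contentSum (Nat.Partition.indiscrete n) = (n.choose 2 : ℕ) := by
  rcases Nat.eq_zero_or_pos n with rfl | hn
  · have h0 : (Nat.Partition.indiscrete 0).youngDiagram.cells = ∅ :=
      Finset.card_eq_zero.mp (Nat.Partition.card_cells_youngDiagram _)
    simp [contentSum, h0]
  · rw [contentSum, cells_youngDiagram_indiscrete hn.ne', Finset.sum_map]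
    simp only [Function.Embedding.coeFn_mk, Nat.cast_zero, sub_zero]
    rw [Nat.choose_two_right, ← Nat.cast_sum]
    have h := Finset.sum_range_id_mul_two n
    have h2 : (∑ i ∈ Finset.range n, i) = n * (n - 1) / 2 := by omega
    rw [h2]

end Content

/-! ### Named facts: the Caputo–Liggett–Richthammer theorem and the complete graph -/

section Facts

/-- **Aldous' spectral gap conjecture, the theorem of Caputo–Liggett–Richthammer**, in the
representation-theoretic form printed by Alon–Kozma (§1, "Theorem (Caputo, Liggett & Richthammer)"):
"For any `A` and any irreducible `ρ` different from the trivial representation `[n]`,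
`λ₁(A; [n−1,1]) ≤ λ₁(A; ρ)`", `A = {a_{ij}}_{1≤i<j≤n}` non-negative (`λ₁ = aldousLambdaOneFin n`;
`[n−1,1]` is the partition with parts `{n−1, 1}`, so `n ≥ 2`). CLR state it as: the spectral gap of
the interchange process on a weighted graph equals that of the random walk (Thm. 1.1); the
translation is Alon–Kozma §1 (after the theorem) and Cesi (2010).
[cite: CaputoLiggettRichthammer2010, Theorem 1.1] [cite: AlonKozma2013, §1 Theorem (CLR)] -/
def CaputoLiggettRichthammer_lambdaOne : Prop :=
  ∀ (n : ℕ) (A : Fin n → Fin n → ℝ), (∀ i j, 0 ≤ A i j) →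
    ∀ (μ ν : Nat.Partition n), ν.parts = ({n - 1, 1} : Multiset ℕ) →
      μ ≠ Nat.Partition.indiscrete n →
      aldousLambdaOneFin n A ν ≤ aldousLambdaOneFin n A μ

/-- Corollary: **`[n−1,1] ⪰ μ` in the Aldous order** for every `μ ≠ [n]` ("and of course the Caputo
et al. result, `[n−1,1] ⪰ ρ` for all `ρ ≠ [n], [n−1,1]`", Alon–Kozma §1).
[cite: AlonKozma2013, §1] -/
theorem CaputoLiggettRichthammer_lambdaOne.aldousLE (h : CaputoLiggettRichthammer_lambdaOne)
    {n : ℕ} {μ ν : Nat.Partition n} (hν : ν.parts = ({n - 1, 1} : Multiset ℕ))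
    (hμ : μ ≠ Nat.Partition.indiscrete n) : AldousLE μ ν :=
  fun A hA => h n A hA μ ν hν hμ

/-- **Diaconis–Shahshahani: `λ₁` of the complete graph.** For `A ≡ 1` (every pair `x < y` at rate
`1`, the complete graph `K_n`), `Δ_{K_n} = ∑_{i<j} (id − (ij))` is central and acts on `[μ]` "via the
scalar `binom(n,2) − ∑_{j=1}^m (binom(l_j − j + 1, 2) − binom(j, 2))`" (`l_j` the rows of `μ`;
Alon–Kozma §3, proof of Lemma 3 (2), from the trace of a transposition on `[μ]`,
Diaconis–Shahshahani Lemma 7), i.e. `binom(n,2) − contentSum μ`; in particular this scalar is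
`λ₁(K_n; μ) = aldousLambdaOneFin n 1 μ`.
[cite: AlonKozma2013, §3 proof of Lemma 3 (2)] [cite: DiaconisShahshahani1981, Lemma 7] -/
def DiaconisShahshahani_lambdaOne_complete : Prop :=
  ∀ (n : ℕ) (μ : Nat.Partition n),
    aldousLambdaOneFin n (fun _ _ => (1 : ℝ)) μ = (n.choose 2 : ℝ) - (contentSum μ : ℝ)

/-- Consistency of the complete-graph formula with `λ₁(A;[n]) = 0`: at `μ = [n]` its right-hand
side vanishes (`contentSum_indiscrete`), as does its left-hand side (`aldousLambdaOneFin_indiscrete`).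
[folklore] -/
theorem choose_two_sub_contentSum_indiscrete (n : ℕ) :
    (n.choose 2 : ℝ) - (contentSum (Nat.Partition.indiscrete n) : ℝ) = 0 := by
  rw [contentSum_indiscrete, Int.cast_natCast, sub_self]

end Facts

end Literature.RepresentationTheory.FiniteGroups

end
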